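import Summits.BirchSwinnertonDyer.BirchSwinnertonDyer.Theorems.BiquadraticEisensteinDescentEisensteinHeartFlatCMInertBadKPrimeShapiroDatumPackaged
import Literature.NumberTheory.GaloisRepresentations.AbsGaloisGroup
import Mathlib.FieldTheory.Galois.Infinite
import Mathlib.GroupTheory.IndexNormal
import HarnessLib

set_option linter.dupNamespace false -- `Summit.BirchSwinnertonDyer.BirchSwinnertonDyer.Theorems.…` (summit = sub)
set_option autoImplicit false

/-!
# Crux `EisensteinHeartFlatCMInertBadKPrime` (stmt-BirchSwinnertonDyer-21341), line `hsieh-lambda`, layer 2 — the CM DATUM ADAPTER: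
# from a geometric endomorphism `ψ` of `E(K̄)` with `ψ² = d₀` that commutes with `σ ∈ Γ_K` up to the sign `σ(√d₀)/√d₀`
# to the socket `(U, φ, hφH′, hφU, hφU′, hφ2)` of `…ShapiroDatumPackaged.heartShape_xac_of_forall_heartShape_upper`

Route `BiquadraticEisensteinDescent` (cell `pub/bsd-wall`, width-prover seat `bsd-wall-cm-bed-w1` g5). The packaged V3 theorem consumes an
index-two open normal subgroup `U ≤ Γ_K` (`U = Γ_L`, `L = K(√d₀) = K·K_CM`) and an endomorphism `φ` of `E[p^∞]` commuting with `U`,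
anti-commuting off `U`, with `φ² = d₀`. This file produces exactly that from the natural geometric input: an additive endomorphism
`ψ` of `E(K̄)` (`= [√d₀]`), a square root `r ∈ K̄` of `d₀` NOT in `K`, and the Galois behaviour `σ ∘ ψ = ±ψ ∘ σ` according to
`σ r = ±r` (Silverman, *Advanced Topics*, II §2, Thm. II.2.2(b): `([α] P)^σ = [α^σ] P^σ`).

* §1 `U := Stab_{Γ_K}(r)`: `smul_eq_self_or_eq_neg` (`σ r = ±r`), `isOpen_stabilizer` (Krull-open: contains `Gal(K̄/K(r))`),
  `fixingSubgroup_adjoin_le_stabilizer` (`U ⊇ Gal(K̄/K(r))`), `exists_smul_eq_neg` (`r ∉ K` ⟹ some `σ` moves `r`, Galois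
  correspondence for `K̄/K`), `smul_eq_neg_of_not_mem` , `index_stabilizer_eq_two`, `normal_stabilizer`.
* §2 `map_mem_geomPrimaryTorsion` (any additive endomorphism preserves `E[p^∞]`), `exists_restrict_geomPrimaryTorsion`.
  U-presentation-free variants `…_of_forall_mem_iff` for any `U` with `σ ∈ U ↔ σ r = r`.
* §3 `exists_cmDatum`: the socket data `(φ, hφH′, hφU, hφU′, hφ2)` for such `U`, from `(ψ, r, hψ₊, hψ₋, hψ2)`.
* §4 **`heartShape_xac_of_sqrt_endomorphism`**: ONE CALL from the geometric CM endomorphism `ψ` (+ `d₀` non-square mod `p`, `X_ac`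
  f.g. torsion, and the ∀-admissible V4-shaped input `hV4`, NOT asserted) to the ♭-heart shape `∃ m, p^m·Ch_Λ(X_ac)·𝓞_ℂp⟦T⟧ ⊆ (Q)`.

THEOREMS ONLY (no definition, no named fact, no instance, no `sorry`); imports no `Theses` module; nothing about V2/V4 or any case of
BSD is asserted; BSD is not proved by any of this. Supports stmt-BirchSwinnertonDyer-21341 as a helper.

References: [SilvermanAdvancedTopics1994] II §2, Thm. II.2.2(b), Example II.2.3.2; [NeukirchANT1999] IV §1; [SilvermanAEC2009] III §7.
-/

noncomputable section

open scoped Classical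

universe u

namespace Summit.BirchSwinnertonDyer.BirchSwinnertonDyer.Theorems.BiquadraticEisensteinDescentEisensteinHeartFlatCMInertBadKPrimeCMDatumAdapter

open Field WeierstrassCurve Literature.NumberTheory.EllipticCurves

/-! ## §1 The index-two subgroup cut out by a square root -/

section Stabilizer

variable {K : Type u} [Field K]

/-- For `r² = d ∈ K`, every `σ ∈ Γ_K` maps `r` to `±r`. [cite: SilvermanAdvancedTopics1994, II §2, Example II.2.3.2] -/
theorem smul_eq_self_or_eq_neg (r : AlgebraicClosure K) (d : K) (hr : r * r = algebraMap K _ d) (σ : absoluteGaloisGroup K) :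
    σ • r = r ∨ σ • r = -r := by
  have h : (σ • r) * (σ • r) = r * r := by rw [← smul_mul', hr, smul_algebraMap σ d]
  have h' : (σ • r - r) * (σ • r + r) = 0 := by linear_combination h
  rcases mul_eq_zero.mp h' with h0 | h0
  · exact Or.inl (sub_eq_zero.mp h0)
  · exact Or.inr (eq_neg_of_add_eq_zero_left h0)

/-- The stabiliser `Stab_{Γ_K}(r)` contains the fixing subgroup `Gal(K̄/K(r))` (they are equal). [cite: NeukirchANT1999, IV §1] -/
theorem fixingSubgroup_adjoin_le_stabilizer (r : AlgebraicClosure K) :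
    ∀ σ ∈ (IntermediateField.adjoin K {r}).fixingSubgroup, σ ∈ MulAction.stabilizer (absoluteGaloisGroup K) r := by
  intro σ hσ
  rw [IntermediateField.mem_fixingSubgroup_iff] at hσ
  exact hσ r (IntermediateField.subset_adjoin K {r} rfl)

/-- `Stab_{Γ_K}(r)` is open for the Krull topology (it contains `Gal(K̄/K(r))`, `K(r)/K` finite).
[cite: NeukirchANT1999, IV §1] -/
theorem isOpen_stabilizer (r : AlgebraicClosure K) :
    IsOpen ((MulAction.stabilizer (absoluteGaloisGroup K) r : Subgroup (absoluteGaloisGroup K)) :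
      Set (absoluteGaloisGroup K)) := by
  let E : IntermediateField K (AlgebraicClosure K) := IntermediateField.adjoin K {r}
  haveI : FiniteDimensional K E :=
    IntermediateField.finiteDimensional_adjoin fun z _ ↦ Algebra.IsIntegral.isIntegral z
  exact Subgroup.isOpen_mono (H₁ := E.fixingSubgroup) (H₂ := MulAction.stabilizer (absoluteGaloisGroup K) r)
    (fixingSubgroup_adjoin_le_stabilizer r) E.fixingSubgroup_isOpen

variable [CharZero K]

/-- If `r ∉ K` then some `σ ∈ Γ_K` moves `r` (Galois correspondence for `K̄/K`, characteristic `0`), hence `σ r = -r` when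
`r² ∈ K`. [cite: SilvermanAdvancedTopics1994, II §2, Example II.2.3.2] -/
theorem exists_smul_eq_neg (r : AlgebraicClosure K) (d : K) (hr : r * r = algebraMap K _ d)
    (hrK : r ∉ Set.range (algebraMap K (AlgebraicClosure K))) : ∃ σ : absoluteGaloisGroup K, σ • r = -r := by
  by_contra h
  have h' : ∀ σ : absoluteGaloisGroup K, σ • r ≠ -r := fun σ hσ ↦ h ⟨σ, hσ⟩
  apply hrK
  rw [InfiniteGalois.mem_range_algebraMap_iff_fixed]
  intro f
  have := (smul_eq_self_or_eq_neg r d hr ((absoluteGaloisGroup.toAlgEquiv K).symm f)).resolve_right (h' _)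
  rwa [absoluteGaloisGroup.toAlgEquiv_symm_apply] at this

omit [CharZero K] in
/-- `r ∉ K` forces `r ≠ 0`. [folklore] -/
theorem ne_zero_of_not_mem_range {r : AlgebraicClosure K} (hrK : r ∉ Set.range (algebraMap K (AlgebraicClosure K))) : r ≠ 0 := by
  rintro rfl; exact hrK ⟨0, map_zero _⟩

/-- In characteristic `0`, `-r = r` only for `r = 0`. [folklore] -/
theorem neg_ne_self_of_ne_zero {r : AlgebraicClosure K} (hr0 : r ≠ 0) : -r ≠ r := by
  intro h
  haveI : CharZero (AlgebraicClosure K) := charZero_of_injective_algebraMap (algebraMap K _).injective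
  have h2 : (2 : AlgebraicClosure K) * r = 0 := by linear_combination -h
  rcases mul_eq_zero.mp h2 with h | h
  · exact two_ne_zero h
  · exact hr0 h

omit [CharZero K] in
/-- Off the stabiliser, `σ r = -r`. [cite: SilvermanAdvancedTopics1994, II §2, Example II.2.3.2] -/
theorem smul_eq_neg_of_not_mem (r : AlgebraicClosure K) (d : K) (hr : r * r = algebraMap K _ d) (σ : absoluteGaloisGroup K)
    (hσ : σ ∉ MulAction.stabilizer (absoluteGaloisGroup K) r) : σ • r = -r :=
  (smul_eq_self_or_eq_neg r d hr σ).resolve_left hσ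

/-- Conversely `σ r = -r` puts `σ` off the stabiliser (`r ∉ K`, characteristic `0`). [folklore] -/
theorem not_mem_of_smul_eq_neg (r : AlgebraicClosure K) (hrK : r ∉ Set.range (algebraMap K (AlgebraicClosure K)))
    (σ : absoluteGaloisGroup K) (hσ : σ • r = -r) : σ ∉ MulAction.stabilizer (absoluteGaloisGroup K) r := by
  intro h
  rw [MulAction.mem_stabilizer_iff] at h
  exact neg_ne_self_of_ne_zero (ne_zero_of_not_mem_range hrK) (hσ.symm.trans h)

/-- **`[Γ_K : Stab(r)] = 2`** for a square root `r ∉ K` of an element of `K` (`Stab(r) = Γ_{K(r)}`, `[K(r) : K] = 2`).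
[cite: SilvermanAdvancedTopics1994, II §2, Example II.2.3.2] -/
theorem index_stabilizer_eq_two (r : AlgebraicClosure K) (d : K) (hr : r * r = algebraMap K _ d)
    (hrK : r ∉ Set.range (algebraMap K (AlgebraicClosure K))) :
    (MulAction.stabilizer (absoluteGaloisGroup K) r).index = 2 := by
  obtain ⟨σ₀, hσ₀⟩ := exists_smul_eq_neg r d hr hrK
  rw [Subgroup.index_eq_two_iff]
  refine ⟨σ₀, fun b ↦ ?_⟩
  simp only [MulAction.mem_stabilizer_iff, mul_smul, hσ₀, smul_neg]
  rcases smul_eq_self_or_eq_neg r d hr b with h | h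
  · rw [h]
    exact Or.inr ⟨rfl, neg_ne_self_of_ne_zero (ne_zero_of_not_mem_range hrK)⟩
  · rw [h, neg_neg]
    exact Or.inl ⟨rfl, neg_ne_self_of_ne_zero (ne_zero_of_not_mem_range hrK)⟩

/-- `Stab(r)` is normal in `Γ_K` (index two). [folklore] -/
theorem normal_stabilizer (r : AlgebraicClosure K) (d : K) (hr : r * r = algebraMap K _ d)
    (hrK : r ∉ Set.range (algebraMap K (AlgebraicClosure K))) :
    (MulAction.stabilizer (absoluteGaloisGroup K) r).Normal :=
  Subgroup.normal_of_index_eq_two (index_stabilizer_eq_two r d hr hrK)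

omit [CharZero K] in
/-- A subgroup `U` described by `σ ∈ U ↔ σ r = r` IS the stabiliser. [folklore] -/
theorem eq_stabilizer_of_forall_mem_iff (r : AlgebraicClosure K) (U : Subgroup (absoluteGaloisGroup K)) (hUr : ∀ σ, σ ∈ U ↔ σ • r = r) :
    U = MulAction.stabilizer (absoluteGaloisGroup K) r :=
  Subgroup.ext fun σ ↦ by rw [hUr, MulAction.mem_stabilizer_iff]

omit [CharZero K] in
/-- `U = {σ | σ r = r}` is open. [cite: NeukirchANT1999, IV §1] -/
theorem isOpen_of_forall_mem_iff (r : AlgebraicClosure K) (U : Subgroup (absoluteGaloisGroup K)) (hUr : ∀ σ, σ ∈ U ↔ σ • r = r) :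
    IsOpen (U : Set (absoluteGaloisGroup K)) := by
  rw [eq_stabilizer_of_forall_mem_iff r U hUr]; exact isOpen_stabilizer r

/-- `U = {σ | σ r = r}` has index `2` (`r ∉ K`, `r² ∈ K`, characteristic `0`). [cite: SilvermanAdvancedTopics1994, II §2, Example II.2.3.2] -/
theorem index_eq_two_of_forall_mem_iff (r : AlgebraicClosure K) (d : K) (hr : r * r = algebraMap K _ d)
    (hrK : r ∉ Set.range (algebraMap K (AlgebraicClosure K))) (U : Subgroup (absoluteGaloisGroup K)) (hUr : ∀ σ, σ ∈ U ↔ σ • r = r) :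
    U.index = 2 := by
  rw [eq_stabilizer_of_forall_mem_iff r U hUr]; exact index_stabilizer_eq_two r d hr hrK

/-- `U = {σ | σ r = r}` is normal. [folklore] -/
theorem normal_of_forall_mem_iff (r : AlgebraicClosure K) (d : K) (hr : r * r = algebraMap K _ d)
    (hrK : r ∉ Set.range (algebraMap K (AlgebraicClosure K))) (U : Subgroup (absoluteGaloisGroup K)) (hUr : ∀ σ, σ ∈ U ↔ σ • r = r) :
    U.Normal :=
  Subgroup.normal_of_index_eq_two (index_eq_two_of_forall_mem_iff r d hr hrK U hUr)

omit [CharZero K] in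
/-- Off `U = {σ | σ r = r}`, `σ r = -r`. [cite: SilvermanAdvancedTopics1994, II §2, Example II.2.3.2] -/
theorem smul_eq_neg_of_not_mem_of_forall_mem_iff (r : AlgebraicClosure K) (d : K) (hr : r * r = algebraMap K _ d)
    (U : Subgroup (absoluteGaloisGroup K)) (hUr : ∀ σ, σ ∈ U ↔ σ • r = r) (σ : absoluteGaloisGroup K) (hσ : σ ∉ U) : σ • r = -r :=
  (smul_eq_self_or_eq_neg r d hr σ).resolve_left fun h ↦ hσ ((hUr σ).mpr h)

end Stabilizer

/-! ## §2 Restricting an endomorphism of `E(K̄)` to `E[p^∞]` -/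

section Restrict

variable {K : Type u} [Field K] (E : WeierstrassCurve K) (p : ℕ) [Fact p.Prime]

omit [Fact p.Prime] in
/-- Any additive endomorphism of `E(K̄)` preserves `E[p^∞]` (`pⁿ ψ P = ψ (pⁿ P) = 0`). [cite: SilvermanAEC2009, III §7] -/
theorem map_mem_geomPrimaryTorsion (ψ : E.geomPoints →+ E.geomPoints) {P : E.geomPoints} (hP : P ∈ E.geomPrimaryTorsion p) :
    ψ P ∈ E.geomPrimaryTorsion p := by
  obtain ⟨n, hn⟩ := (AddCommGroup.mem_primaryComponent).mp hP
  exact (AddCommGroup.mem_primaryComponent).mpr ⟨n, by rw [← map_nsmul, hn, map_zero]⟩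

omit [Fact p.Prime] in
/-- The restriction `ψ|E[p^∞]` as an endomorphism of `E[p^∞]`. [cite: SilvermanAEC2009, III §7] -/
theorem exists_restrict_geomPrimaryTorsion (ψ : E.geomPoints →+ E.geomPoints) :
    ∃ φ : E.geomPrimaryTorsion p →+ E.geomPrimaryTorsion p, ∀ m, ((φ m : E.geomPrimaryTorsion p) : E.geomPoints) = ψ m :=
  ⟨(ψ.restrict (E.geomPrimaryTorsion p)).codRestrict (E.geomPrimaryTorsion p) fun m ↦ map_mem_geomPrimaryTorsion E p ψ m.2,
    fun _ ↦ rfl⟩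

end Restrict

/-! ## §3 The CM datum -/

section Datum

variable {K : Type u} [Field K] (E : WeierstrassCurve K) (p : ℕ) [Fact p.Prime]

omit [Fact p.Prime] in
/-- **The CM datum of the V3 socket.** Let `ψ` be an additive endomorphism of `E(K̄)` with `ψ ∘ ψ = d₀`, `r ∈ K̄` with `r² = d₀`,
`U ≤ Γ_K` the subgroup `{σ | σ r = r}`, and suppose `σ ∘ ψ = ψ ∘ σ` when `σ r = r` and `σ ∘ ψ = -ψ ∘ σ` when `σ r = -r`. Then the
restriction `φ := ψ|E[p^∞]` commutes with every subgroup `H ≤ U` and with `U`, anti-commutes off `U`, and satisfies `φ ∘ φ = d₀`.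
This is the input `(φ, hφH′, hφU, hφU′, d₀, hφ2)` of `…ShapiroDatumPackaged.heartShape_xac_of_forall_heartShape_upper`.
[cite: SilvermanAdvancedTopics1994, II §2, Thm. II.2.2(b)] -/
theorem exists_cmDatum (ψ : E.geomPoints →+ E.geomPoints) (d₀ : ℤ) (r : AlgebraicClosure K) (hr : r * r = algebraMap K _ (d₀ : K))
    (U : Subgroup (absoluteGaloisGroup K)) (hUr : ∀ σ, σ ∈ U ↔ σ • r = r)
    (hψU : ∀ σ : absoluteGaloisGroup K, σ • r = r → ∀ P : E.geomPoints, σ • ψ P = ψ (σ • P))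
    (hψU' : ∀ σ : absoluteGaloisGroup K, σ • r = -r → ∀ P : E.geomPoints, σ • ψ P = -ψ (σ • P))
    (hψ2 : ∀ P, ψ (ψ P) = d₀ • P) :
    ∃ φ : E.geomPrimaryTorsion p →+ E.geomPrimaryTorsion p,
      (∀ m, ((φ m : E.geomPrimaryTorsion p) : E.geomPoints) = ψ m) ∧
      (∀ H : Subgroup (absoluteGaloisGroup K), H ≤ U → ∀ (x : H) (m : E.geomPrimaryTorsion p), φ (x • m) = x • φ m) ∧
      (∀ σ ∈ U, ∀ m : E.geomPrimaryTorsion p, φ (σ • m) = σ • φ m) ∧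
      (∀ σ, σ ∉ U → ∀ m : E.geomPrimaryTorsion p, φ (σ • m) = -(σ • φ m)) ∧
      (∀ m, φ (φ m) = d₀ • m) := by
  obtain ⟨φ, hφ⟩ := exists_restrict_geomPrimaryTorsion E p ψ
  have hU : ∀ σ ∈ U, ∀ m : E.geomPrimaryTorsion p, φ (σ • m) = σ • φ m := by
    intro σ hσ m
    apply Subtype.ext
    rw [hφ, primaryComponent.coe_smul, primaryComponent.coe_smul, hφ]
    exact (hψU σ ((hUr σ).mp hσ) _).symm
  refine ⟨φ, hφ, fun H hH x m ↦ ?_, hU, fun σ hσ m ↦ ?_, fun m ↦ ?_⟩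
  · rw [Subgroup.smul_def, Subgroup.smul_def]
    exact hU _ (hH x.2) m
  · apply Subtype.ext
    rw [hφ, primaryComponent.coe_smul, AddSubgroup.coe_neg, primaryComponent.coe_smul, hφ]
    have := hψU' σ (smul_eq_neg_of_not_mem_of_forall_mem_iff r (d₀ : K) hr U hUr σ hσ) (m : E.geomPoints)
    rw [this, neg_neg]
  · apply Subtype.ext
    rw [hφ, hφ, hψ2, AddSubgroup.coe_zsmul]

end Datum

/-! ## §4 One call from the geometric CM endomorphism -/

section Heart

open NumberField IsDedekindDomain PowerSeries
  Literature.NumberTheory.EllipticCurves.GreenbergSelmer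
  Literature.NumberTheory.EllipticCurves.Module
  Literature.NumberTheory.EllipticCurves.IwasawaDual Literature.NumberTheory.GaloisRepresentations
  Summit.BirchSwinnertonDyer.Rank1Residual.X11b Summit.BirchSwinnertonDyer.Rank1Residual.X11b.AcSelmer
  Summit.BirchSwinnertonDyer.BirchSwinnertonDyer.Theorems.BiquadraticEisensteinDescentDefs
  Summit.BirchSwinnertonDyer.BirchSwinnertonDyer.Theorems.BiquadraticEisensteinDescentEisensteinHeartFlatCMInertBadKPrimeSelmerTower
  Summit.BirchSwinnertonDyer.BirchSwinnertonDyer.Theorems.BiquadraticEisensteinDescentEisensteinHeartFlatCMInertBadKPrimeShapiroDatum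
  Summit.BirchSwinnertonDyer.BirchSwinnertonDyer.Theorems.BiquadraticEisensteinDescentEisensteinHeartFlatCMInertBadKPrimeShapiroDatumPackaged
  Summit.BirchSwinnertonDyer.BirchSwinnertonDyer.Theorems.BiquadraticEisensteinDescentEisensteinHeartFlatCMInertBadKPrimeUnramifiedQuadraticRing

variable {K : Type u} [Field K] [NumberField K] (E : WeierstrassCurve K) {p : ℕ} [Fact p.Prime]
  (κ : ZpExtension K p) (𝔭 : HeightOneSpectrum (𝓞 K)) (S : Set (HeightOneSpectrum (𝓞 K)))
  (U : Subgroup (absoluteGaloisGroup K)) [U.Normal]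

/-- **♭-heart shape of `Ch_Λ(X_ac)` from the geometric CM endomorphism and V4.** Inputs: `p ≠ 2`; the CM endomorphism `ψ = [√d₀]` of
`E(K̄)` as an additive map with its Galois behaviour `σ ∘ ψ = ±ψ ∘ σ` (sign `σ r / r`, `r = √d₀ ∈ K̄ ∖ K`) and `ψ ∘ ψ = d₀`; the
index-two subgroup `U = {σ | σ r = r} = Γ_{K(√d₀)}` (ANY presentation); `d₀` a non-square mod `p`; `γ` ANY topological generator of
`κ`; `X_ac` finitely generated torsion; and `hV4`: the V4-shaped divisibility for the upper module `N` for every admissible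
`(φ = ψ|E[p^∞], γ′ ∈ U, f, h, δ, b, ι)`. Output: `∃ m, p^m · Ch_Λ(X_ac) · 𝓞_{ℂ_p}⟦T⟧ ⊆ (Q)`. Composition of `exists_cmDatum`, §1 and
`…ShapiroDatumPackaged.heartShape_xac_of_forall_heartShape_upper`; `hV4` is NOT asserted. [cite: PollackRubin2004, proof of Thm. 7.3]
[cite: SilvermanAdvancedTopics1994, II §2, Thm. II.2.2(b)] -/
theorem heartShape_xac_of_sqrt_endomorphism (hp2 : p ≠ 2) (γ : absoluteGaloisGroup K) [Fact (κ.IsTopGenerator γ)]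
    (ψ : E.geomPoints →+ E.geomPoints) (d₀ : ℤ) (r : AlgebraicClosure K) (hr : r * r = algebraMap K _ (d₀ : K))
    (hrK : r ∉ Set.range (algebraMap K (AlgebraicClosure K))) (hUr : ∀ σ, σ ∈ U ↔ σ • r = r)
    (hψU : ∀ σ : absoluteGaloisGroup K, σ • r = r → ∀ P : E.geomPoints, σ • ψ P = ψ (σ • P))
    (hψU' : ∀ σ : absoluteGaloisGroup K, σ • r = -r → ∀ P : E.geomPoints, σ • ψ P = -ψ (σ • P))
    (hψ2 : ∀ P, ψ (ψ P) = d₀ • P) (hd : ∀ y : ZMod p, y * y ≠ PadicInt.toZMod ((d₀ : ℤ) : ℤ_[p]))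
    [Module.Finite (IwasawaAlgebra p) (XAc E p κ 𝔭 S γ)] (hM : Module.IsTorsion (IwasawaAlgebra p) (XAc E p κ 𝔭 S γ))
    {Q : PowerSeries 𝓞_ℂ_[p]}
    (hV4 : ∀ (φ : E.geomPrimaryTorsion p →+ E.geomPrimaryTorsion p) (_ : ∀ m, ((φ m : E.geomPrimaryTorsion p) : E.geomPoints) = ψ m)
      (hφH' : ∀ (x : (κ.kerSubgroup ⊓ U : Subgroup (absoluteGaloisGroup K))) (m : E.geomPrimaryTorsion p), φ (x • m) = x • φ m)
      (hφU : ∀ σ ∈ U, ∀ m : E.geomPrimaryTorsion p, φ (σ • m) = σ • φ m)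
      (hφU' : ∀ σ, σ ∉ U → ∀ m : E.geomPrimaryTorsion p, φ (σ • m) = -(σ • φ m))
      (hφ2 : ∀ m, φ (φ m) = d₀ • m)
      (γ' : absoluteGaloisGroup K) (_ : κ.IsTopGenerator γ') (_ : γ' ∈ U)
      (f : AddMonoid.End (selmerOver (κ.kerSubgroup ⊓ U) (E.geomPrimaryTorsion p) p 𝔭 S))
      (_hf : ∀ s, ((f s : selmerOver (κ.kerSubgroup ⊓ U) (E.geomPrimaryTorsion p) p 𝔭 S) :
        subgroupH1 (κ.kerSubgroup ⊓ U) (E.geomPrimaryTorsion p)) = conjH1 (κ.kerSubgroup ⊓ U) (E.geomPrimaryTorsion p) γ' s)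
      (h : IsLocNil p (f - 1))
      (δ : LocNilDual (selmerOver (κ.kerSubgroup ⊓ U) (E.geomPrimaryTorsion p) p 𝔭 S) f h →ₗ[IwasawaAlgebra p]
        LocNilDual (selmerOver (κ.kerSubgroup ⊓ U) (E.geomPrimaryTorsion p) p 𝔭 S) f h)
      (hδ : ∀ (x : LocNilDual (selmerOver (κ.kerSubgroup ⊓ U) (E.geomPrimaryTorsion p) p 𝔭 S) f h)
        (s t : selmerOver (κ.kerSubgroup ⊓ U) (E.geomPrimaryTorsion p) p 𝔭 S),
        (t : subgroupH1 (κ.kerSubgroup ⊓ U) (E.geomPrimaryTorsion p)) =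
          resH1Hom (ContinuousMonoidHom.id _) φ hφH' (s : subgroupH1 (κ.kerSubgroup ⊓ U) (E.geomPrimaryTorsion p)) → δ x s = x t)
      (b : Module.Basis (Fin 2) ℤ_[p] (AdjoinRoot (Polynomial.X ^ 2 - Polynomial.C ((d₀ : ℤ) : ℤ_[p]) : Polynomial ℤ_[p]))) (hb0 : b 0 = 1)
      (hb1 : b 1 * b 1 = algebraMap ℤ_[p] (AdjoinRoot (Polynomial.X ^ 2 - Polynomial.C ((d₀ : ℤ) : ℤ_[p]) : Polynomial ℤ_[p])) ((d₀ : ℤ) : ℤ_[p]))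
      (ι : AdjoinRoot (Polynomial.X ^ 2 - Polynomial.C ((d₀ : ℤ) : ℤ_[p]) : Polynomial ℤ_[p]) →+* 𝓞_ℂ_[p])
      (_ : ι.comp (algebraMap ℤ_[p] _) = R1.toCpInt p),
      ∃ m : ℕ, ∀ x ∈ (charIdeal (PowerSeries (AdjoinRoot (Polynomial.X ^ 2 - Polynomial.C ((d₀ : ℤ) : ℤ_[p]) : Polynomial ℤ_[p])))
          (WithQuadratic (LocNilDual (selmerOver (κ.kerSubgroup ⊓ U) (E.geomPrimaryTorsion p) p 𝔭 S) f h) b hb0 hb1 δ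
            (delta_sq E κ 𝔭 S U φ hφH' hφU hφU' d₀ hφ2 f h δ hδ))).map (PowerSeries.map ι),
        (PowerSeries.C ((p : ℕ) : 𝓞_ℂ_[p]) : PowerSeries 𝓞_ℂ_[p]) ^ m * x ∈ Ideal.span {Q}) :
    ∃ m : ℕ, ∀ x ∈ (XAc.charIdeal E p κ 𝔭 S γ).map (PowerSeries.map (R1.toCpInt p)),
      (PowerSeries.C ((p : ℕ) : 𝓞_ℂ_[p]) : PowerSeries 𝓞_ℂ_[p]) ^ m * x ∈ Ideal.span {Q} := by
  have hU : IsOpen (U : Set (absoluteGaloisGroup K)) := isOpen_of_forall_mem_iff r U hUr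
  have hU2 : U.index = 2 := index_eq_two_of_forall_mem_iff r (d₀ : K) hr hrK U hUr
  obtain ⟨φ, hφψ, hφH, hφU, hφU', hφ2⟩ := exists_cmDatum E p ψ d₀ r hr U hUr hψU hψU' hψ2
  exact heartShape_xac_of_forall_heartShape_upper E κ 𝔭 S U hp2 hU hU2 γ φ (hφH _ inf_le_right) hφU hφU' d₀ hφ2 hd hM
    (hV4 φ hφψ (hφH _ inf_le_right) hφU hφU' hφ2)

end Heart

end Summit.BirchSwinnertonDyer.BirchSwinnertonDyer.Theorems.BiquadraticEisensteinDescentEisensteinHeartFlatCMInertBadKPrimeCMDatumAdapter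

end
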